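import Summits.BirchSwinnertonDyer.BirchSwinnertonDyer.Theorems.EisensteinPrimesMazurMCOnCellBTwistbackLamOneRankOne
import Summits.BirchSwinnertonDyer.BirchSwinnertonDyer.Theorems.EisensteinPrimesMazurMCOnCellBTwistbackKLFlatPartner
import Literature.NumberTheory.EllipticCurves.GlobalMinimalModelProofs
import HarnessLib

/-!
# Crux 3 `MazurMCOnCellB` (stmt-BirchSwinnertonDyer-19033), line `twistback` v4 — road (d′), the DOOR:
# stub 6 (∃-PARTNER) at `(W, p)` from ONE admissible `K` with a KL-flat balance-1 carrier, the partner's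
# analytic rank being DERIVED (p645525 §3 with `hr1` discharged)

Width seat bsd-line-x2-p1-w5 (g0), 2026-08-28; sequel of `…TwistbackLamOneRankOne` (road (d′) core). HONEST FRAMING
(cell `bsd-eis`, run/shared/lean/pub/bsd-eis/): conditional theorem only. Named facts BY NAME: the route's
`PublishedInputs` (stmt-…-19037), Disegni 2020 Thm. 4(1) (`padicBSD_rankOne_nonsplitMult`, PUB), Greenberg–Vatsal
Thm. (3.11)+(28) (`thm311_…`, PUB), Dokchitser–Dokchitser 2010 Thm. 1.4 (`selmerCorank_mod_two_eq`, PUB) and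
Keller–Yin 2024 Thm. E (`thmE_pConverse_semistable_OPEN`, multiplicative half = Cor. 5.2.2, UNREFEREED PREPRINT resting
on Castella arXiv:2409.01360 — the theorem below is conditional on that OPEN claim; the line already carries Keller–Yin
Thm. D, PRE, as stub 3a). No `def`, no `sorry`; no main conjecture / BSD proved for any curve unconditionally;
0 cells / labels / stubs / tiers move.

WHAT. LEAD g10's door p645525 §3 `upperPartner_at_of_klFlat_partner` gives stub 6's conclusion at a NON-split X2b pair
`(W, p)` from ONE admissible `K` with (i) `hr1 : ord_{s=1} L(E^{(d_K)}, s) = 1` and (ii) a KL-flat balance-1 carrier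
for every minimal model of the twist. Here (i) is REMOVED: the carrier's own two-engine certificate `(μ_an, λ_an) =
(0, 1)` (F1, `…LambdaFromCharacters`), the odd analytic rank of a Heegner twist of a rank-zero curve, `p`-parity and
the multiplicative Eisenstein `p`-converse give `hr1` (`…TwistbackLamOneRankOne` §1–§3). So on the sub-row
«non-split, balance 1, ramified-even carrier» (∃-PARTNER) needs only the EXISTENCE of an admissible `K` whose
carrier character has `p ∤ (1 − χ(p))·B_{1,χ}` (a class-number condition — Kriz–Li 2019 Thm. 9.4 FIRST assertion =
Nakagawa–Horie + Taya supplies such `K` with positive density; not used here) and the twist-character dictionary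
making the carrier data functions of `(E, K)` — no analytic-rank input, no `p`-adic `L`-function, height or
Schneider hypothesis, no Kriz–Li Thm. 1.20 (vacuous on this sub-row: its hypotheses force balance `0`).

References: [GreenbergVatsal2000] §3 Thm. (3.11), §2 p. 28; [Disegni2020] Thm. 4; [Wuthrich2014] Thm. 16;
[DokchitserDokchitserAnnals2010] Thm. 1.4; [KellerYin2024] Thm. E (arXiv:2402.12781v2, PRE); [SilvermanAEC2009]
VIII.8 Cor. 8.3; [KrizLi2019] Thm. 9.4 (first assertion).
-/

set_option autoImplicit false

-- `Summit.BirchSwinnertonDyer.BirchSwinnertonDyer.…`: the summit and its single sub-problem share a name.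
set_option linter.dupNamespace false

noncomputable section

open scoped Classical MatrixGroups ModularForm

open CongruenceSubgroup WeierstrassCurve NumberField IsDedekindDomain Field PowerSeries
  Literature.NumberTheory.EllipticCurves
  Literature.NumberTheory.GaloisRepresentations
  Literature.NumberTheory.EllipticCurves.ModularForms
  Literature.NumberTheory.QuadraticFields
  Literature.NumberTheory.EllipticCurves.Rank1Residual
  Literature.NumberTheory.EllipticCurves.Rank1Residual.Typed
  Literature.NumberTheory.EllipticCurves.Wuthrich2014
  Literature.NumberTheory.EllipticCurves.SteinWuthrich2013
  Literature.NumberTheory.EllipticCurves.GreenbergVatsal2000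
  Literature.NumberTheory.EllipticCurves.Disegni2020
  Literature.NumberTheory.EllipticCurves.KellerYin2024
  Summit.BirchSwinnertonDyer.Rank1Residual
  Summit.BirchSwinnertonDyer.Rank1Residual.X2
  Summit.BirchSwinnertonDyer.Rank1Residual.X2.IsogenyQuotientLine
  Summit.BirchSwinnertonDyer.BirchSwinnertonDyer.Theses
  Summit.BirchSwinnertonDyer.BirchSwinnertonDyer.Theorems.EisensteinPrimesLambdaFromCharacters
  Summit.BirchSwinnertonDyer.BirchSwinnertonDyer.Theorems.EisensteinPrimesMazurMCOnCellBTwistbackKLFlatPartner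
  Summit.BirchSwinnertonDyer.BirchSwinnertonDyer.Theorems.EisensteinPrimesMazurMCOnCellBTwistbackLamOneRankOne

namespace Summit.BirchSwinnertonDyer.BirchSwinnertonDyer.Theorems.EisensteinPrimesMazurMCOnCellBTwistbackLamOnePartner

/-! ## Road (d′): stub 6 (∃-PARTNER) at `(W, p)` from ONE admissible `K` with a KL-flat balance-1 carrier —
the analytic rank of the partner is DERIVED -/

/-- **Stub 6's conclusion AT ONE X2b pair (VERBATIM shape) from a KL-FLAT PARTNER, the partner's analytic rank being
an OUTPUT** — p645525 §3 `upperPartner_at_of_klFlat_partner` with its hypothesis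
`hr1 : (W.quadraticTwist d_K).analyticRank = 1` DISCHARGED: for a NON-split X2b pair `(W, p)` (so
`ord_{s=1} L(E, s) = 0`) and ONE admissible `K` (imaginary quadratic, Heegner for `N_W` and for `p`, `d_K` odd
`< −4`) such that every globally minimal model `Wd` of `E^{(d_K)}` has a KL-FLAT CARRIER (`V′` isogenous to `Wd`
with a ramified-even rational line, primitive characters `φ`, `ψ`, `‖L_∅(C,0)‖ = ‖L_∅(D,0)‖ = 1`, local balance
`1`), the partner clause of `stub_upperPartner` holds at `(W, p)` with this `K`. Route: pick a minimal model `Wd`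
(Silverman VIII.8.3), its carrier `V′`; F1 (`…LambdaFromCharacters`, GV Thm. (3.11) `h311` + Wuthrich) gives
`(μ_an, λ_an)(V′, p) = (0, 1)`; `r_an(V′) = r_an(Wd) = r_an(E^{(d_K)})` is odd (core file §2, `r_an(E) = 0`); core file §3 (Dokchitser
`hDD` + Keller–Yin Thm. E `hKY`, PRE) gives `r_an(V′) = 1`, i.e. `hr1`; then p645525 §3 verbatim. So on the
sub-row «non-split, balance 1, ramified-even carrier» (∃-PARTNER) needs only the EXISTENCE of an admissible `K` with
`p ∤ (1 − χ(p))·B_{1,χ}` for the carrier's odd character (a class-number condition; Kriz–Li 2019 Thm. 9.4 FIRST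
assertion = Nakagawa–Horie + Taya supply such `K` with positive density) — no analytic-rank input, no `p`-adic
`L`-function, height or Schneider hypothesis. Inputs BY NAME: `PublishedInputs`, Disegni Thm. 4(1), GV Thm. (3.11),
Dokchitser (PUB); Keller–Yin Thm. E (PRE). [claim: KellerYin2024, status: under-review]
[cite: GreenbergVatsal2000, §3 Thm. (3.11) (p. 43) and §2 p. 28] [cite: Disegni2020, Thm. 4 (§3.2)]
[cite: Wuthrich2014, Thm. 16 (p. 397)] [cite: DokchitserDokchitserAnnals2010, Thm. 1.4]
[cite: SilvermanAEC2009, VIII.8 Cor. 8.3] [cite: KrizLi2019, Thm. 9.4 (first assertion; the supply of K, not used)] -/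
theorem upperPartner_at_of_klFlat_partner_of_thmE (hP : EisensteinPrimes.PublishedInputs)
    (hDis : padicBSD_rankOne_nonsplitMult) (h311 : thm311_hasUnitContent_iff_and_order_eq_of_lineRamifiedEven)
    (hDD : ∀ (V : WeierstrassCurve ℚ) [V.IsElliptic] (ℓ : ℕ) [Fact ℓ.Prime], selmerCorank_mod_two_eq V ℓ)
    (hKY : thmE_pConverse_semistable_OPEN)
    (W : WeierstrassCurve ℚ) [W.IsElliptic] [W.IsGloballyMinimal] (p : ℕ) [Fact p.Prime]
    (hc : X2.CellB W p) (hns : ¬ W.HasSplitMultiplicativeReductionAtPrime p)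
    (K : Type) [Field K] [NumberField K] (hK : IsImaginaryQuadratic K)
    (hHN : SatisfiesHeegnerHypothesis (W.conductorNorm ℤ) K) (hHp : SatisfiesHeegnerHypothesis p K)
    (hodd : Odd (NumberField.discr K)) (hlt : NumberField.discr K < -4)
    (hKL : ∀ (Wd : WeierstrassCurve ℚ) [Wd.IsElliptic] [Wd.IsGloballyMinimal],
      (∃ C : VariableChange ℚ, C • Wd = W.quadraticTwist (NumberField.discr K : ℚ)) →
      ∃ (V' : WeierstrassCurve ℚ) (_ : V'.IsElliptic) (_ : V'.IsGloballyMinimal), IsIsogenous Wd V' ∧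
        ∃ (S₀ : Finset (HeightOneSpectrum (𝓞 ℚ))) (Φ₀ : AddSubgroup (V'.geomTorsion (p : ℤ)))
          (m : ℕ) (_ : NeZero m) (φ : DirichletCharacter (ZMod p) m)
          (d : ℕ) (_ : NeZero d) (ψ : DirichletCharacter (ZMod p) d),
          IsRationalLine V' p Φ₀ ∧ ¬ LineUnramifiedAt V' p Φ₀ ∧ LineEven V' p Φ₀ ∧
          φ.IsPrimitive ∧ ψ.IsPrimitive ∧ p ∣ m ∧ ¬ p ∣ d ∧
          (∀ (σ : absoluteGaloisGroup ℚ), ∀ Q ∈ Φ₀,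
            σ • Q = (φ ((modNCyclotomicCharacter ℚ m σ : (ZMod m)ˣ) : ZMod m)).val • Q) ∧
          (∀ (σ : absoluteGaloisGroup ℚ) (Q : V'.geomTorsion (p : ℤ)),
            σ • Q - (ψ ((modNCyclotomicCharacter ℚ d σ : (ZMod d)ˣ) : ZMod d)).val • Q ∈ Φ₀) ∧
          (∀ v ∈ S₀, ((p : ℕ) : 𝓞 ℚ) ∉ v.asIdeal) ∧
          (∀ v : HeightOneSpectrum (𝓞 ℚ), v ∉ S₀ → ((p : ℕ) : 𝓞 ℚ) ∉ v.asIdeal →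
            V'.HasGoodReductionAt v) ∧
          ‖characterLValueC p φ ∅ 1‖ = 1 ∧ ‖characterLValueD p ψ ∅ 1‖ = 1 ∧
          1 + ∑ v ∈ S₀, delta V' p v =
            ∑ v ∈ S₀, ((if φ (Rat.HeightOneSpectrum.natGenerator v : ZMod m) =
                  (Rat.HeightOneSpectrum.natGenerator v : ZMod p)
                then sFactor p (Rat.HeightOneSpectrum.natGenerator v) else 0) +
              (if ψ (Rat.HeightOneSpectrum.natGenerator v : ZMod d) =
                  (Rat.HeightOneSpectrum.natGenerator v : ZMod p)
                then sFactor p (Rat.HeightOneSpectrum.natGenerator v) else 0))) :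
    ∃ (K : Type) (_ : Field K) (_ : NumberField K), IsImaginaryQuadratic K ∧
      SatisfiesHeegnerHypothesis (W.conductorNorm ℤ) K ∧ SatisfiesHeegnerHypothesis p K ∧
      Odd (NumberField.discr K) ∧ NumberField.discr K < -4 ∧
      (W.quadraticTwist (NumberField.discr K : ℚ)).analyticRank = 1 ∧
      ∀ (Wd : WeierstrassCurve ℚ) [Wd.IsElliptic] [Wd.IsGloballyMinimal],
        (∃ C : VariableChange ℚ, C • Wd = W.quadraticTwist (NumberField.discr K : ℚ)) →
        MissingUpperBoundAt Wd p := by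
  have hpar := hP.2.2.2.2.1
  have hnf := hP.2.2.2.2.2.1
  have hWu := hP.2.2.2.2.2.2.2.2.2.2.2.2.2.2.1
  have hp2 : p ≠ 2 := hc.2.1.1
  have hmult : W.HasMultiplicativeReductionAtPrime p := hc.2.1.2.2
  have hr0 : W.analyticRank = 0 := hc.1
  have hdK : (NumberField.discr K : ℚ) ≠ 0 := by exact_mod_cast NumberField.discr_ne_zero K
  haveI := W.isElliptic_quadraticTwist hdK
  -- a globally minimal model `Wd` of the twist (Silverman VIII.8.3) and its KL-flat carrier `V'`
  obtain ⟨C₀, hC₀⟩ := hasGlobalMinimalModel_rat_holds (W.quadraticTwist (NumberField.discr K : ℚ))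
  set Wd : WeierstrassCurve ℚ := C₀ • W.quadraticTwist (NumberField.discr K : ℚ) with hWd_def
  haveI : Wd.IsGloballyMinimal := hC₀
  have hWd : ∃ C : VariableChange ℚ, C • Wd = W.quadraticTwist (NumberField.discr K : ℚ) :=
    ⟨C₀⁻¹, inv_smul_smul C₀ _⟩
  obtain ⟨V', _, _, hiso, S₀, Φ₀, m, _, φ, d, _, ψ, hΦ, hram, heven, hφ, hψ, hpm, hpd, hφ0, hψ0, hS₀p, hS,
    hC1, hD1, hbal⟩ := hKL Wd hWd
  -- the carrier is NON-split multiplicative at `p` with `E[p]` reducible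
  obtain ⟨C, hC⟩ := hWd
  have hXd : ClassX2 Wd p := X2.classX2_twist W p hc.2.1 K hK hHp Wd ⟨C, hC⟩
  have hnsd : ¬ Wd.HasSplitMultiplicativeReductionAtPrime p := fun hs ↦
    hns ((X2.hasSplitMultiplicativeReductionAtPrime_iff_of_smul_eq_quadraticTwist W Wd hK p hp2 hmult hHp
      hC).mp hs)
  have hmult' : V'.HasMultiplicativeReductionAtPrime p :=
    hasMultiplicativeReductionAtPrime_of_isIsogenous hiso hXd.2.2
  have hns' : ¬ V'.HasSplitMultiplicativeReductionAtPrime p := fun hs ↦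
    hnsd ((hasSplitMultiplicativeReductionAtPrime_iff_of_isIsogenous (p := p) hiso).mpr hs)
  have hred' : ¬ V'.HasIrreducibleModPGaloisRep p := not_hasIrreducibleModPGaloisRep_of_isRationalLine hΦ
  -- F1: the two-engine certificate `(μ_an, λ_an)(V', p) = (0, 1)` from the KL-flat character data
  obtain ⟨hμ, hlam⟩ := analyticMuLE_zero_and_analyticLambdaEq_of_lineRamifiedEven_of_klFlat V' p h311 hWu S₀ Φ₀
    m φ d ψ hp2 hmult' hΦ hram heven hφ hψ hpm hpd hφ0 hψ0 hS₀p hS hC1 hD1 1 hbal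
  -- the analytic rank of the carrier is odd: `r_an(V') = r_an(Wd) = r_an(E^{(d_K)})`, odd by the core file §2
  have hrd : Wd.analyticRank = (W.quadraticTwist (NumberField.discr K : ℚ)).analyticRank := by
    have h := congrArg WeierstrassCurve.analyticRank hC
    rwa [analyticRank_smul] at h
  have hrV : V'.analyticRank = (W.quadraticTwist (NumberField.discr K : ℚ)).analyticRank := by
    rw [← analyticRank_eq_of_isIsogenous' hiso, hrd]
  have hoddV : Odd V'.analyticRank := by
    rw [hrV]
    exact odd_analyticRank_quadraticTwist_of_analyticRank_eq_zero hnf W hr0 K hK hHN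
  -- core file §3: `r_an(V') = 1`, hence `r_an(E^{(d_K)}) = 1`
  have hr1' : V'.analyticRank = 1 :=
    analyticRank_eq_one_of_analyticLambdaEq_one_of_odd hWu hpar hKY V' p (hDD V' p) hp2 hmult' hns' hred' hoddV
      hμ hlam
  have hr1 : (W.quadraticTwist (NumberField.discr K : ℚ)).analyticRank = 1 := by rw [← hrV, hr1']
  -- road (d)'s door with `hr1` discharged
  exact upperPartner_at_of_klFlat_partner hP hDis h311 W p hc hns K hK hHN hHp hodd hlt hr1 hKL

end Summit.BirchSwinnertonDyer.BirchSwinnertonDyer.Theorems.EisensteinPrimesMazurMCOnCellBTwistbackLamOnePartner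

end
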